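import Summits.RiemannHypothesis.RiemannHypothesis.Theorems.EarlyAppointmentsRemainder0XiPairSumRe
import Summits.RiemannHypothesis.RiemannHypothesis.Theorems.EarlyAppointmentsRemainder0XiEtaLedgerArith
import Summits.RiemannHypothesis.RiemannHypothesis.Theorems.EarlyAppointmentsRemainder0XiWindowReindex

/-!
# ⟨24730⟩ ρ2 — (CA403)(ii) the far field, re-indexed: `farField w` as the limit of the FAR Hadamard pair sums

C4 «kernel desk» rh-idea-6 g30, director (CA403)(ii)/(CA404).  SUPPORT module for crux r3 `Remainder0Xi`
(stmt-RiemannHypothesis-24730), line `Cruxes/Remainder0Xi/Lines/rho2_v3.lean`, stub `stub_farAbel : FarAbel`;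
fully proved, tree imports only, standard axioms.

* §0 — the Theorems-side mirror of the registry's `farField` (registry `Lines/rho2_v2.lean` l.50–55 = `rho2_v3.lean`,
  BODY VERBATIM, namespace `…Cruxes.Remainder0Xi.Rho2V2` exactly as #1042 mirrors `mainIntegral` and
  `…EtaLedgerArith` mirrors `T_PT`, `boxHalfWidth`, …): `FAR(w) = Ξ′/Ξ(w) − ∑_{Ξ u = 0, |Re u − Re w| < 135/2} ord_u · (w − u)⁻¹`.
* §1–§2 (helper namespace `…Theorems.EarlyAppointmentsRemainder0Xi.FarFieldReindex`) — for `Re w > 135/2` (every `w` of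
  the FarAbel box: `boxHalfWidth_lt_re_of_box`) and `Ξ w ≠ 0`:
  ★ `farField_tendsto`: `∑ᶠ_{Ξ ρ = 0, 0 < Re ρ ≤ T, |Re ρ − Re w| ≥ 135/2} ord_ρ · 2w/(w² − ρ²) ⟶ FAR(w) − ∑ᶠ_{near u} ord_u · (w + u)⁻¹`
  as `T → ∞` — i.e. the far field is the far part of the (correctly height-selected) Hadamard pair expansion
  `PairSumRe.pairSum_re` plus the finitely many partner terms `(w + u)⁻¹` of the near zeros (each of size `< 1/T_PT`
  in the FarAbel box).  This is the plumbing identity the Abel-summation step (CA403)(iii) starts from.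
Nothing here bears on the truth of RH; RH is not proved; 24730 OPEN.
-/

noncomputable section

set_option linter.dupNamespace false

open Literature.NumberTheory.LFunctions

namespace Summit.RiemannHypothesis.RiemannHypothesis.Cruxes.Remainder0Xi.Rho2V2

/-- The far field. (registry `Cruxes/Remainder0Xi/Lines/rho2_v2.lean` l.50–55, body verbatim) -/
noncomputable def farField (w : ℂ) : ℂ :=
  deriv riemannXiUpper w / riemannXiUpper w -
    ∑ᶠ u ∈ {u : ℂ | riemannXiUpper u = 0 ∧ |u.re - w.re| < boxHalfWidth},
      ((analyticOrderAt riemannXiUpper u).toNat : ℂ) * (w - u)⁻¹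

end Summit.RiemannHypothesis.RiemannHypothesis.Cruxes.Remainder0Xi.Rho2V2

namespace Summit.RiemannHypothesis.RiemannHypothesis.Theorems.EarlyAppointmentsRemainder0Xi.FarFieldReindex

open Complex Filter Topology Set
open Summit.RiemannHypothesis.RiemannHypothesis.Cruxes.Remainder0Xi.Rho2V2 (T_PT boxHalfWidth farField)
open Summit.RiemannHypothesis.RiemannHypothesis.Theorems.EarlyAppointmentsRemainder0Xi.PairSumRe (pairSum_re)
open Summit.RiemannHypothesis.RiemannHypothesis.Theorems.WindowReindex (xiWindowZeros_finite)

/-! ## §1 The one-sided box, its near window and its far part -/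

/-- Zeros of `Ξ` with height `0 < Re ρ ≤ T` (one of each `±` pair). -/
def posBox (T : ℝ) : Set ℂ := {ρ : ℂ | riemannXiUpper ρ = 0 ∧ 0 < ρ.re ∧ ρ.re ≤ T}

/-- The near window of `w` (the zeros subtracted in `farField w`). -/
def nearWin (w : ℂ) : Set ℂ := {u : ℂ | riemannXiUpper u = 0 ∧ |u.re - w.re| < boxHalfWidth}

/-- The far part of the one-sided box. -/
def farBox (w : ℂ) (T : ℝ) : Set ℂ :=
  {ρ : ℂ | riemannXiUpper ρ = 0 ∧ 0 < ρ.re ∧ ρ.re ≤ T ∧ boxHalfWidth ≤ |ρ.re - w.re|}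

/-- The one-sided box is finite. -/
theorem posBox_finite (T : ℝ) : (posBox T).Finite := by
  refine (xiWindowZeros_finite (T / 2) (T / 2 + 1)).subset ?_
  rintro ρ ⟨h0, h1, h2⟩
  refine ⟨h0, ?_⟩
  rw [abs_lt]
  constructor <;> linarith

/-- The near window is finite. -/
theorem nearWin_finite (w : ℂ) : (nearWin w).Finite := xiWindowZeros_finite w.re boxHalfWidth

/-- The far box is contained in the one-sided box. -/
theorem farBox_subset (w : ℂ) (T : ℝ) : farBox w T ⊆ posBox T :=
  fun _ ⟨h0, h1, h2, _⟩ ↦ ⟨h0, h1, h2⟩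

/-- The far box is finite. -/
theorem farBox_finite (w : ℂ) (T : ℝ) : (farBox w T).Finite := (posBox_finite T).subset (farBox_subset w T)

/-- In the FarAbel box (`γ > T_PT`, `|Re w − γ| ≤ 135/2`) one has `Re w > 135/2`. -/
theorem boxHalfWidth_lt_re_of_box {γ : ℝ} {w : ℂ} (hγ : T_PT < γ) (hw : |w.re - γ| ≤ boxHalfWidth) :
    boxHalfWidth < w.re := by
  have h1 := (abs_le.1 hw).1
  have hT : T_PT = 3000175332800 := rfl
  have hB : boxHalfWidth = 135 / 2 := rfl
  rw [hT] at hγ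
  rw [hB] at h1 ⊢
  linarith

/-- A near zero has positive height once `Re w > 135/2`. -/
theorem re_pos_of_mem_nearWin {w u : ℂ} (hre : boxHalfWidth < w.re) (hu : u ∈ nearWin w) : 0 < u.re := by
  have h := (abs_lt.1 hu.2).1
  have hB : (0 : ℝ) ≤ boxHalfWidth := by norm_num [boxHalfWidth]
  linarith

/-- The near window is contained in the one-sided box. -/
theorem nearWin_subset {w : ℂ} {T : ℝ} (hre : boxHalfWidth < w.re) (hT : w.re + boxHalfWidth ≤ T) :
    nearWin w ⊆ posBox T := by
  intro u hu
  have h := (abs_lt.1 hu.2).2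
  exact ⟨hu.1, re_pos_of_mem_nearWin hre hu, by linarith⟩

/-- The one-sided box is the disjoint union of the far box and near window. -/
theorem posBox_eq_union {w : ℂ} {T : ℝ} (hre : boxHalfWidth < w.re) (hT : w.re + boxHalfWidth ≤ T) :
    posBox T = farBox w T ∪ nearWin w := by
  ext ρ
  constructor
  · rintro ⟨h0, h1, h2⟩
    by_cases hfar : boxHalfWidth ≤ |ρ.re - w.re|
    · exact Or.inl ⟨h0, h1, h2, hfar⟩
    · exact Or.inr ⟨h0, not_le.1 hfar⟩
  · rintro (hρ | hρ)
    · exact farBox_subset w T hρ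
    · exact nearWin_subset hre hT hρ

/-- The far box and near window are disjoint. -/
theorem disjoint_farBox_nearWin (w : ℂ) (T : ℝ) : Disjoint (farBox w T) (nearWin w) := by
  rw [Set.disjoint_left]
  rintro ρ ⟨-, -, -, hfar⟩ ⟨-, hnear⟩
  exact absurd hnear (not_lt.2 hfar)

/-- Splitting a sum over the one-sided box into its far and near parts. -/
theorem finsum_posBox_eq {w : ℂ} {T : ℝ} (hre : boxHalfWidth < w.re) (hT : w.re + boxHalfWidth ≤ T)
    (f : ℂ → ℂ) :
    ∑ᶠ ρ ∈ posBox T, f ρ = ∑ᶠ ρ ∈ farBox w T, f ρ + ∑ᶠ u ∈ nearWin w, f u := by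
  rw [posBox_eq_union hre hT]
  exact finsum_mem_union (disjoint_farBox_nearWin w T) (farBox_finite w T) (nearWin_finite w)

/-! ## §2 The far field as the limit of the far pair sums -/

/-- `2w/(w² − u²) = (w − u)⁻¹ + (w + u)⁻¹`. -/
theorem pair_split {w u : ℂ} (h1 : w - u ≠ 0) (h2 : w + u ≠ 0) :
    2 * w / (w ^ 2 - u ^ 2) = (w - u)⁻¹ + (w + u)⁻¹ := by
  have e : w ^ 2 - u ^ 2 = (w - u) * (w + u) := by ring
  rw [e]
  field_simp
  ring

/-- The near pair terms split into the subtracted terms `(w − u)⁻¹` and the partner terms `(w + u)⁻¹`. -/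
theorem finsum_nearWin_pairs {w : ℂ} (hw : riemannXiUpper w ≠ 0) (hre : boxHalfWidth < w.re) :
    ∑ᶠ u ∈ nearWin w, ((analyticOrderAt riemannXiUpper u).toNat : ℂ) * 2 * w / (w ^ 2 - u ^ 2) =
      ∑ᶠ u ∈ nearWin w, ((analyticOrderAt riemannXiUpper u).toNat : ℂ) * (w - u)⁻¹ +
        ∑ᶠ u ∈ nearWin w, ((analyticOrderAt riemannXiUpper u).toNat : ℂ) * (w + u)⁻¹ := by
  rw [← finsum_mem_add_distrib (nearWin_finite w)]
  refine finsum_mem_congr rfl fun u hu ↦ ?_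
  have h1 : w - u ≠ 0 := by
    intro e
    rw [sub_eq_zero] at e
    exact hw (e ▸ hu.1)
  have h2 : w + u ≠ 0 := by
    intro e
    have hre' := congrArg Complex.re e
    rw [add_re, zero_re] at hre'
    have hB : (0 : ℝ) ≤ boxHalfWidth := by norm_num [boxHalfWidth]
    linarith [re_pos_of_mem_nearWin hre hu]
  rw [mul_assoc, mul_div_assoc, pair_split h1 h2, mul_add]

/-- ★ **The far field, re-indexed** ((CA403)(ii)): for `Re w > 135/2` and `Ξ(w) ≠ 0`, the far Hadamard pair sums
`∑_{Ξ ρ = 0, 0 < Re ρ ≤ T, |Re ρ − Re w| ≥ 135/2} ord_ρ · 2w/(w² − ρ²)` converge, as `T → ∞`, to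
`farField w − ∑_{Ξ u = 0, |Re u − Re w| < 135/2} ord_u · (w + u)⁻¹`. -/
theorem farField_tendsto (w : ℂ) (hw : riemannXiUpper w ≠ 0) (hre : boxHalfWidth < w.re) :
    Tendsto (fun T : ℝ =>
      ∑ᶠ ρ ∈ {ρ : ℂ | riemannXiUpper ρ = 0 ∧ 0 < ρ.re ∧ ρ.re ≤ T ∧ boxHalfWidth ≤ |ρ.re - w.re|},
        ((analyticOrderAt riemannXiUpper ρ).toNat : ℂ) * 2 * w / (w ^ 2 - ρ ^ 2)) atTop
      (𝓝 (farField w - ∑ᶠ u ∈ {u : ℂ | riemannXiUpper u = 0 ∧ |u.re - w.re| < boxHalfWidth},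
        ((analyticOrderAt riemannXiUpper u).toNat : ℂ) * (w + u)⁻¹)) := by
  set f : ℂ → ℂ := fun ρ ↦ ((analyticOrderAt riemannXiUpper ρ).toNat : ℂ) * 2 * w / (w ^ 2 - ρ ^ 2)
    with hf
  have hpair : Tendsto (fun T : ℝ => ∑ᶠ ρ ∈ posBox T, f ρ) atTop
      (𝓝 (deriv riemannXiUpper w / riemannXiUpper w)) := pairSum_re w hw
  have hlim := hpair.sub_const (∑ᶠ u ∈ nearWin w, f u)
  have hev : ∀ᶠ T in atTop, ∑ᶠ ρ ∈ posBox T, f ρ - ∑ᶠ u ∈ nearWin w, f u = ∑ᶠ ρ ∈ farBox w T, f ρ := by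
    filter_upwards [eventually_ge_atTop (w.re + boxHalfWidth)] with T hT
    rw [finsum_posBox_eq hre hT f, add_sub_cancel_right]
  have hval : deriv riemannXiUpper w / riemannXiUpper w - ∑ᶠ u ∈ nearWin w, f u =
      farField w - ∑ᶠ u ∈ nearWin w, ((analyticOrderAt riemannXiUpper u).toNat : ℂ) * (w + u)⁻¹ := by
    simp only [hf]
    rw [finsum_nearWin_pairs hw hre, farField]
    show _ = deriv riemannXiUpper w / riemannXiUpper w - ∑ᶠ u ∈ nearWin w, _ - _
    ring
  rw [hval] at hlim
  exact hlim.congr' hev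

/-- The same statement with the box hypotheses of `FarAbel` (`γ > T_PT`, `|Re w − γ| ≤ 135/2`). -/
theorem farField_tendsto_of_box {γ : ℝ} (hγ : T_PT < γ) (w : ℂ) (hwγ : |w.re - γ| ≤ boxHalfWidth)
    (hw : riemannXiUpper w ≠ 0) :
    Tendsto (fun T : ℝ =>
      ∑ᶠ ρ ∈ {ρ : ℂ | riemannXiUpper ρ = 0 ∧ 0 < ρ.re ∧ ρ.re ≤ T ∧ boxHalfWidth ≤ |ρ.re - w.re|},
        ((analyticOrderAt riemannXiUpper ρ).toNat : ℂ) * 2 * w / (w ^ 2 - ρ ^ 2)) atTop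
      (𝓝 (farField w - ∑ᶠ u ∈ {u : ℂ | riemannXiUpper u = 0 ∧ |u.re - w.re| < boxHalfWidth},
        ((analyticOrderAt riemannXiUpper u).toNat : ℂ) * (w + u)⁻¹)) :=
  farField_tendsto w hw (boxHalfWidth_lt_re_of_box hγ hwγ)

end Summit.RiemannHypothesis.RiemannHypothesis.Theorems.EarlyAppointmentsRemainder0Xi.FarFieldReindex

end
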